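import Mathlib
import Literature.Algebra.Polynomial.NewtonPolytope
import Literature.Barriers.PneNP.TSPExtensionComplexityFaces
import Literature.Computability.AlgebraicComplexity.NestFreeMatchingPoly
import Literature.Computability.AlgebraicComplexity.MonotoneCircuitNewtonPolytopeXC
import Summits.ValiantsHypothesis.ValiantsHypothesis.Theorems.FifoMatchingNNLinearDegreeCofactorHardAvoidingMatchings
import Summits.ValiantsHypothesis.ValiantsHypothesis.Theorems.FifoMatchingNFPolytopeQueueGridFaceDefs
import Summits.ValiantsHypothesis.ValiantsHypothesis.Theorems.FifoMatchingNFPolytopeQuasiPolyXCHolds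
import HarnessLib

/-!
# HD-1: the monomial rung `NNMonomialCofactorHard` (stmt-ValiantsHypothesis-26253) holds

The route `ValiantsHypothesis/FifoMatching` item HD-1 `NNMonomialCofactorHard`: for every `c`, eventually in `n`, for EVERY monomial
`x^e` (arbitrary degree), the monotone (`ℝ≥0`) fan-in-two circuit complexity of `NN_n · x^e` exceeds `2^((log₂ n + c)^c)` — monomial
cofactors of any degree do not help the nest-free (FIFO) matching polynomial in the monotone world.

PROVED (port of `hd1_of_xc` of the line workfile `Cruxes/NNLinearDegreeCofactorHard/Lines/next_rung_dual.lean` @46c477a09103, val-idea-7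
lineage, with its two named inputs now THEOREMS of the tree): `Newt(NN_n · x^e) = Newt(NN_n) + e` is a TRANSLATE of `NFP(2n)`
(`newt_mul_monomial`) and extension complexity is translation-invariant (`hasEFOfSize_add_singleton`), so the DEGREE-FREE, LINEAR
monotone-circuit ⇒ extended-formulation bound P1 — `MonotoneCircuitEF.hasEFOfSize_newtonPolytope_complexity` (`xc(Newt f) ≤ 3·L₊(f)`,
Hrubeš–Yehudayoff 2021 Thm 35 in circuit form, `Literature/…/MonotoneCircuitNewtonPolytopeXC.lean`; bridge `newt_eq_newtonPolytope` to
c1's `QueueGridFace.newt`, val-lit-p10 g2's checked recipe) — turns an `L₊` bound for `NN_n · x^e` into an EF bound for `NFP(2n)`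
UNIFORMLY in `e`, and K1 `QueueGridFace.nfPolytopeQuasiPolyXC_holds` (stmt-26254, closed today; route decl ↔ c1's vocabulary by `rfl`)
forbids quasi-polynomial EFs; the thresholds `2^((log₂ n + c)^c)` absorb the constant `3` (`threshold_room`).  Filed by the prover seat
val-port-4 g1 (val-lit desk g12 RULING #275 (a); by-name reader val-lit-p10 g2).  No new definitions: `realOf` / `suppPts` / `newt` are
c1 g5's canonical `QueueGridFace` declarations (p613693).

Honest frame: a support/crux item of route FifoMatching on the MONOTONE side; `NNDivisionHard` (stmt-21181), `NNNotVP` and the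
Valiant summit remain OPEN; VP ≠ VNP is NOT proved; nothing here is a summit statement.
-/

noncomputable section

-- Sub = Summit single-conjunct layout: the duplicated namespace component is mandated by the tree.
set_option linter.dupNamespace false

namespace Summit.ValiantsHypothesis.ValiantsHypothesis.Theorems.FifoMatching

namespace MonomialCofactor

open Matrix MvPolynomial Literature.Computability.AlgebraicComplexity Literature.Barriers.PneNP
open Literature.Algebra.Polynomial.NewtonPolytope
open scoped NNReal Pointwise
open Summit.ValiantsHypothesis.ValiantsHypothesis.Theorems.FifoMatching.QueueGridFace (realOf suppPts newt)

variable {σ : Type}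

/-! ## Translation invariance of extension complexity -/

/-- `realOf` is additive: the real point of `d + e` is the sum of the real points. [folklore] -/
theorem realOf_add (d e : σ →₀ ℕ) : realOf (d + e) = realOf d + realOf e := by
  funext i
  simp [realOf, Nat.cast_add]

/-- Translating a set does not change the size of its extended formulations (shift the right-hand side `g` by `E v`).
[folklore] -/
theorem hasEFOfSize_add_singleton {ι : Type} [Fintype ι] {P : Set (ι → ℝ)} {r : ℕ}
    (h : HasEFOfSize P r) (v : ι → ℝ) : HasEFOfSize (P + {v}) r := by
  obtain ⟨Q, hQ⟩ := h
  refine ⟨⟨Q.k, Q.E, Q.F, Q.g + Q.E.mulVec v⟩, ?_⟩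
  ext x
  simp only [ExtendedFormulation.projSet, Set.mem_setOf_eq, Set.add_singleton, Set.mem_image, ← hQ]
  constructor
  · rintro ⟨y, hy, hE⟩
    refine ⟨x - v, ⟨y, hy, ?_⟩, sub_add_cancel x v⟩
    rw [Matrix.mulVec_sub]
    have : Q.E *ᵥ x + Q.F *ᵥ y - Q.E *ᵥ v = Q.g := by rw [hE]; abel
    rw [← this]; abel
  · rintro ⟨z, ⟨y, hy, hE⟩, rfl⟩
    refine ⟨y, hy, ?_⟩
    rw [Matrix.mulVec_add, ← hE]; abel

/-! ## Newton polytope of a monomial multiple = translate -/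

/-- Support of `f · x^e` = support of `f` shifted by `e` (a monomial with coefficient `1` is regular). [folklore] -/
theorem support_mul_monomial_one (f : MvPolynomial σ ℝ≥0) (e : σ →₀ ℕ) :
    (f * monomial e 1).support = f.support.map (addRightEmbedding e) := by
  classical
  exact AddMonoidAlgebra.support_coeff_mul_single f _ (by simp) _

/-- `suppPts (f · x^e) = suppPts f + {e}`. [folklore] -/
theorem suppPts_mul_monomial (f : MvPolynomial σ ℝ≥0) (e : σ →₀ ℕ) :
    suppPts (f * monomial e 1) = suppPts f + {realOf e} := by
  classical
  ext x
  simp only [suppPts, support_mul_monomial_one, Finset.coe_map, Set.add_singleton, Set.mem_image,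
    Finset.mem_coe, addRightEmbedding_apply]
  constructor
  · rintro ⟨d', ⟨d, hd, rfl⟩, rfl⟩
    exact ⟨realOf d, ⟨d, hd, rfl⟩, (realOf_add d e).symm⟩
  · rintro ⟨y, ⟨d, hd, rfl⟩, rfl⟩
    exact ⟨d + e, ⟨d, hd, rfl⟩, realOf_add d e⟩

/-- `Newt(f · x^e) = Newt(f) + {e}`. [folklore] -/
theorem newt_mul_monomial (f : MvPolynomial σ ℝ≥0) (e : σ →₀ ℕ) :
    newt (f * monomial e 1) = newt f + {realOf e} := by
  rw [newt, suppPts_mul_monomial, convexHull_add, convexHull_singleton, newt]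

/-- c1's `QueueGridFace.newt` is the Literature `newtonPolytope` of the real-coefficient copy (val-lit-p10 g2's bridge). [folklore] -/
theorem newt_eq_newtonPolytope (f : MvPolynomial σ ℝ≥0) :
    newt f = newtonPolytope (MvPolynomial.map NNReal.toRealHom f) := by
  unfold newt suppPts newtonPolytope
  rw [MvPolynomial.support_map_of_injective _ NNReal.coe_injective]
  rfl

/-- **P1 is a theorem of the tree (degree-free, linear):** every nonzero-or-not `f ∈ ℝ≥0[x]` has an extended formulation of `Newt f`
with at most `3 · L₊(f) + 3` inequalities (`MonotoneCircuitEF.hasEFOfSize_newtonPolytope_complexity`, Hrubeš–Yehudayoff Thm 35 in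
circuit form, sizes padded by `+ 3`). [cite: HrubesYehudayoff2021, Theorem 35 (§5.4)] -/
theorem hasEFOfSize_newt {τ : Type} [Fintype τ] [DecidableEq τ] (f : MvPolynomial τ ℝ≥0) :
    HasEFOfSize (newt f) (3 * complexity f + 3) := by
  rw [newt_eq_newtonPolytope]
  exact (MonotoneCircuitEF.hasEFOfSize_newtonPolytope_complexity f).of_le (Nat.le_add_right _ _)

/-- `NN_n ≠ 0`: the nest-free perfect matchings of `[2n]` are nonempty (`AvoidingMatchings.exists_nestFree_avoiding ∅`). [folklore] -/
theorem nn_ne_zero (n : ℕ) : nestFreeMatchingPoly n ℝ≥0 ≠ 0 := by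
  classical
  obtain ⟨M, hM, -⟩ :=
    Summit.ValiantsHypothesis.ValiantsHypothesis.Theorems.FifoMatching.NNLinearDegreeCofactorHard.AvoidingMatchings.exists_nestFree_avoiding
      (n := n) ∅ (by simp)
  intro h0
  have hmem : arcExponent M ∈ (nestFreeMatchingPoly n ℝ≥0).support := by
    rw [support_nestFreeMatchingPoly]
    exact Finset.mem_image_of_mem _ hM
  rw [h0, support_zero] at hmem
  simp at hmem

/-! ## Threshold arithmetic -/

/-- room between consecutive quasi-polynomial thresholds absorbs the constant of P1:
`C·2^((L+c)^c) + C ≤ 2^((L+c+C)^(c+C))` for `C, L ≥ 2`. [folklore] -/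
theorem threshold_room (C c L : ℕ) (hC : 2 ≤ C) (hL : 2 ≤ L) :
    C * 2 ^ ((L + c) ^ c) + C ≤ 2 ^ ((L + (c + C)) ^ (c + C)) := by
  set A := (L + c) ^ c with hA
  have hx : 2 ≤ L + c := by omega
  -- (L + c + C)^(c+C) ≥ (L+c)^c * (L+c+C)^C ≥ A * 2^C
  have h1 : A * 2 ^ C ≤ (L + (c + C)) ^ (c + C) := by
    have e1 : (L + (c + C)) ^ (c + C) = (L + (c + C)) ^ c * (L + (c + C)) ^ C := by rw [pow_add]
    rw [e1]
    apply Nat.mul_le_mul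
    · exact Nat.pow_le_pow_left (by omega) c
    · exact Nat.pow_le_pow_left (by omega) C
  -- 2^C ≥ C + 2 for C ≥ 2
  have h2C : C + 2 ≤ 2 ^ C := by
    clear h1 hx hA hL A
    induction C, hC using Nat.le_induction with
    | base => norm_num
    | succ m hm ih => rw [pow_succ]; omega
  have hA1 : 1 ≤ A := Nat.one_le_pow _ _ (by omega)
  -- A * 2^C ≥ A + C + 1
  have h2 : A + C + 1 ≤ A * 2 ^ C := by
    calc A + C + 1 ≤ A + A * (C + 1) := by nlinarith
      _ = A * (C + 2) := by ring
      _ ≤ A * 2 ^ C := Nat.mul_le_mul_left A h2C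
  have h3 : A + C + 1 ≤ (L + (c + C)) ^ (c + C) := h2.trans h1
  -- C * 2^A + C ≤ 2^(A + C + 1)
  have hC2 : C ≤ 2 ^ C := (Nat.lt_two_pow_self).le
  calc C * 2 ^ A + C ≤ 2 ^ C * 2 ^ A + 2 ^ C * 2 ^ A := by
          have : C ≤ 2 ^ C * 2 ^ A := hC2.trans (Nat.le_mul_of_pos_right _ (Nat.two_pow_pos A))
          nlinarith [Nat.mul_le_mul_right (2 ^ A) hC2]
    _ = 2 ^ (A + C + 1) := by rw [pow_add, pow_add, pow_one]; ring
    _ ≤ 2 ^ ((L + (c + C)) ^ (c + C)) := Nat.pow_le_pow_right (by norm_num) h3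

/-! ## HD-1 -/

/-- **HD-1 ⇐ P1 ∧ K1, both now theorems** — the workfile's `hd1_of_xc` with its inputs discharged: monomial cofactors of ANY degree
are free in the polyhedral currency (`Newt(NN_n · x^e)` is a translate of `NFP(2n)`, EF size is translation-invariant), so K1's
super-quasi-polynomial extension complexity of `NFP(2n)` and the linear bound `xc(Newt f) ≤ 3·L₊(f) + 3` give
`2^((log₂ n + c)^c) < L₊(NN_n · x^e)` for all large `n`, uniformly in `e`.  Stated over the library polynomial
`nestFreeMatchingPoly n ℝ≥0` (= the route's inlined `NN_n` by `rfl`). [folklore assembly; inputs HrubesYehudayoff2021 Thm 35,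
AboulkerEtAl2019 Thm 6 via K1] -/
theorem nnMonomialCofactorHard_lib :
    ∀ c : ℕ, ∃ n₀ : ℕ, ∀ n ≥ n₀, ∀ e : (Fin (2 * n) × Fin (2 * n)) →₀ ℕ,
      2 ^ ((Nat.log 2 n + c) ^ c) < complexity (nestFreeMatchingPoly n ℝ≥0 * monomial e 1) := by
  classical
  -- K1 (stmt-26254, closed) in c1's vocabulary: the route decl unfolds to this text by `rfl`
  have hK : ∀ c : ℕ, ∃ n₀ : ℕ, ∀ n ≥ n₀, ∀ r : ℕ,
      HasEFOfSize (newt (nestFreeMatchingPoly n ℝ≥0)) r → 2 ^ ((Nat.log 2 n + c) ^ c) < r :=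
    Summit.ValiantsHypothesis.ValiantsHypothesis.Theorems.FifoMatching.QueueGridFace.nfPolytopeQuasiPolyXC_holds
  intro c
  obtain ⟨n₀, hn₀⟩ := hK (c + 3)
  refine ⟨max n₀ 4, fun n hn e => ?_⟩
  have hn₀' : n₀ ≤ n := (le_max_left _ _).trans hn
  have hn4 : 4 ≤ n := (le_max_right _ _).trans hn
  have hL : 2 ≤ Nat.log 2 n := by
    have : Nat.log 2 4 = 2 := by decide
    rw [← this]; exact Nat.log_mono_right hn4
  set f := nestFreeMatchingPoly n ℝ≥0 * monomial e 1 with hf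
  -- EF of Newt(f) of size 3·L₊(f) + 3, hence of its translate Newt(NN_n) = Newt(f) + {-e}
  have hEF := hasEFOfSize_newt f
  have hnewt : newt f = newt (nestFreeMatchingPoly n ℝ≥0) + {realOf e} := by
    rw [hf]; exact newt_mul_monomial _ _
  have hEF' : HasEFOfSize (newt (nestFreeMatchingPoly n ℝ≥0)) (3 * complexity f + 3) := by
    have := hasEFOfSize_add_singleton hEF (-(realOf e))
    rwa [hnewt, add_assoc, Set.singleton_add_singleton, add_neg_cancel, Set.singleton_zero, add_zero] at this
  have hlt := hn₀ n hn₀' _ hEF'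
  -- 2^((L + c + 3)^(c+3)) < 3 s + 3  and  3·2^((L+c)^c) + 3 ≤ 2^((L+c+3)^(c+3))  ⇒  2^((L+c)^c) < s
  by_contra hle
  push Not at hle
  have hroom : 3 * 2 ^ ((Nat.log 2 n + c) ^ c) + 3 ≤ 2 ^ ((Nat.log 2 n + (c + 3)) ^ (c + 3)) :=
    threshold_room 3 c (Nat.log 2 n) (by norm_num) hL
  have h' : 3 * complexity f + 3 ≤ 3 * 2 ^ ((Nat.log 2 n + c) ^ c) + 3 :=
    Nat.add_le_add_right (Nat.mul_le_mul_left 3 hle) 3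
  omega

end MonomialCofactor

/-- **Item stmt-ValiantsHypothesis-26253 `NNMonomialCofactorHard` (HD-1) — proved** (exact type of the route decl; the route inlines
`NN_n = nestFreeMatchingPoly n ℝ≥0` verbatim, so this is `MonomialCofactor.nnMonomialCofactorHard_lib` by definitional unfolding).
[cite: HrubesYehudayoff2021, Theorem 35; AboulkerEtAl2019, Theorem 6] -/
theorem nnMonomialCofactorHard_holds :
    Summit.ValiantsHypothesis.ValiantsHypothesis.Theses.FifoMatching.NNMonomialCofactorHard :=
  MonomialCofactor.nnMonomialCofactorHard_lib

end Summit.ValiantsHypothesis.ValiantsHypothesis.Theorems.FifoMatching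

end
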